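/-
Copyright (c) 2026 the pub-hodgecm-mathlib formalisation cell (harness21).  Prover seat hodgecm-mathlib-R90-C133-p02 (g0), Track B ∕ R90-TF, h413 = `stmt-HodgeConjecture-24833`,
R90-TF section S8 «ContSpec-n½» (deal F5, S8-R40∕S8-R42 of R90-CS-plan (g2), 2026-09-04T22:20Z): R4-χ₃ — the pole dichotomy of the continued `χ`-scattering coordinate of `U(2,1)` on
`{1 < Re z}` (normalisation `s = z − 1`), twin of ★ p862111 `K2E1ChiScatteringPoleDichotomyU2`; generic analysis + the `N = 3` coordinate with the scalar's continuation taken in the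
SHAPE of F4's MAIN (`(z−2)(2z−3)·c(z) = G(z)`), so that the χ-instance is a plug BY NAME.
-/
import Summits.HodgeConjecture.HodgeConjecture.Theorems.K2E1ChiScatteringPoleDichotomyU2     -- ★ p862111 (K2E2-p12): §1 generics `tendsto_sub_mul_zero_of_eventuallyEq_analyticAt`, `eq_zero_of_tendsto_sub_mul_of_eventuallyEq_analyticAt`; brings ★ J2 (b), ★ `countable_of_codiscrete`, ★ `isPreconnected_convex_diff_of_countable`
import Summits.HodgeConjecture.HodgeConjecture.Theorems.K2E1ChiIntertwiningScalarEulerQuotientU3CM   -- ★ p862563 (R90-CS-p03, F4 CM print): `exists_differentiableOn_mul_chiScalar_cm_three` (ED. 2); brings ★ `LHalfNeZero`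
import HarnessLib

/-!
# K2·E1 ∕ R90·S8 — `K2E1ChiScatteringPoleDichotomyU3`: THE POLE DICHOTOMY OF THE `χ`-SCATTERING COORDINATE OF `U(J₃) = U(2,1)_{L∕L⁺}` ON `{1 < Re z}` —
# a NON-ZERO residue of `qc` sits at `z = 2` or at `z = 3/2`, with the residues `A(2)·G(2)` resp. `−A(3/2)·G(3/2)` read off the continuation `G` of `(z−2)(2z−3)·c_χ^S(z)`

Track B ∕ R90-TF, crux h413 = `stmt-HodgeConjecture-24833`, route of record `HCCMUnconditional`; cell `hodgecm-mathlib`, R90-TF section S8 «ContSpec-n½ ∕ ResidualSpectrum», row F5 of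
R90-C14-p02's G-side census («R4-χ₃: poles of `M(·,χ)` in `Re s > 0` = {1 if φ = 1} ∪ {½ if φ′ = ω ∧ L(½,φ) ≠ 0}, residues elsewhere 0», [Rogawski1990, §13.9 p. 229 (i)(ii)]) — an input
of socket #3 `sock_S8_res_piN_occurs` and of #2♯ (i)(ii) of `Lines/R90_S8_ResidualSpectrumU3B.lean`.  THEOREMS ONLY (no `def`, no `instance`, no notation, no named-fact hypothesis, no
`sorry`; default heartbeats); lane `--supports stmt-HodgeConjecture-24833 --as helper` (count-neutral).  CLOSES NO SOCKET.

NORMALISATION (R90-C10-p07 CENSUS-sock3-piN §A = R90-CS-p03 CENSUS-F4 §0): Rogawski's `s` ↔ E1's `z` at `N = 3` by `s = z − 1`; Godement tube `{2 < Re z}`; unitary axis `Re z = 1`;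
pole (i) `z = 2` (`s = 1`), pole (ii) `z = 3/2` (`s = ½`).  The unramified scalar is `c_χ^S(z) = [L_E^S(z−1, φ)·L_F^T(2z−2, η)] ∕ [L_E^S(z, φ)·L_F^T(2z−1, η)]` (`E = L`, `F = L⁺`,
`η = φ′·ω_{L∕L⁺}`) — F4 `K2E1ChiIntertwiningScalarEulerQuotientU3` (R90-CS-p03) continues `(z−2)(2z−3)·c_χ^S(z)` to a holomorphic `G` on `{1 < Re}` with `G 2 ≠ 0 ↔ φ = 1`,
`η ≠ 1 → G (3/2) = 0`, `η = 1 → φ ≠ 1 → (G (3/2) ≠ 0 ↔ L(½, φ) ≠ 0)`.  THIS FILE takes that continuation IN SHAPE — an abstract scalar `M : ℂ → ℂ` with `hGeq : (z−2)(2z−3)·M z = G z` on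
the tube — so every statement below is pure complex analysis plus the E1 package clauses; the χ-instance (F4's bytes for `M`, the character form of the two residue conditions) is a plug by name.
THE DATA (hypothesis-first, ★ J2 (b)'s clause shapes with `1 ↦ 2`): ONE coordinate of a continued scattering package — tube value `q`, continuation `qc` analytic off the co-discrete `P`,
`qc = q` on `{2 < Re}` (`hqcq hPcd hqa`); the one-source letter `hsrc : q z = A z * M z` on the tube with `A` holomorphic on `{1 < Re}` (B1-local ∕ B2's junction, discharged elsewhere).
* §1 GENERIC: `eqOn_halfPlane_of_eqOn_tube_of_weight` — the PARAMETRIC identity transfer (abscissa `a`, tube `b`, entire weight `w`; ★ J2 (b) §1 is the case `½, 1, z−1`);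
  `exists_analyticAt_eventuallyEq_of_weight_ne_zero` (off the zeros of `w`, `f` is regular); `tendsto_sub_mul_of_weight` (at a simple zero `w = (·−z₀)·w₁`: `(z−z₀)·f z → A z₀·G z₀ ∕ w₁ z₀`);
  `exists_analyticAt_eventuallyEq_of_apply_eq_zero` (if moreover `G z₀ = 0`, `f` is regular at `z₀` — the `dslope` device of ★ J2 (b) §3).
* §2 THE `N = 3` COORDINATE: `weight_mul_qc_eq_three` (`(z−2)(2z−3)·qc = A·G` on `{1 < Re} ∖ P`); `residue_eq_zero_of_ne_two_of_ne_three_halves`; `tendsto_sub_two_mul_qc` (`→ A 2 * G 2`);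
  `tendsto_sub_three_halves_mul_qc` (`→ −(A (3/2) * G (3/2))`); `exists_analyticAt_eventuallyEq_qc_of_apply_two_eq_zero` ∕ `…_three_halves_eq_zero` (regularity when `G` vanishes);
  **`poles_subset_of_residue_ne_zero`** — THE DICHOTOMY in the pole currency (`Sp ⊂ (1, σ₀)` finite, residue letters `hr`): `ρ c ≠ 0 → (c = 2 ∧ ρ c = A 2 * G 2) ∨ (c = 3/2 ∧ ρ c = −(A (3/2) * G (3/2)))`,
  and `forall_residue_eq_zero_of_apply_eq_zero` (`G 2 = 0 → G (3/2) = 0 → ∀ c ∈ Sp, ρ c = 0`).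
* §3 (ED. 2) THE CM PRINT BY NAME at ★ F4 `exists_differentiableOn_mul_chiScalar_cm_three` (R90-CS-p03, p862563): `M := c_χ^S` = `[L_L^S(z−1,φ)·L_{L⁺}^T(2z−2,η)]∕[L_L^S(z,φ)·L_{L⁺}^T(2z−1,η)]`
  in its bytes; **`forall_poles_of_residue_ne_zero_cm_three`**: `ρ c ≠ 0 → (c = 2 ∧ φ = 1 ∧ A 2 ≠ 0) ∨ (c = 3/2 ∧ η = 1 ∧ A (3/2) ≠ 0 ∧ (φ ≠ 1 → LHalfNeZero φ))`;
  `forall_residue_eq_zero_cm_three` (`φ ≠ 1`, and `η = 1 → ¬ LHalfNeZero φ` ⇒ no weighted pole); `residue_at_two_eq_cm_three` (`ρ = A 2 * G 2`, `≠ 0 ↔ φ = 1 ∧ A 2 ≠ 0`).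
HONEST LABEL: HC_CM is proved only modulo the 7 printed citations (2 remaining named inputs: hLiu418 = `stmt-HodgeConjecture-24832`, h413 = `stmt-HodgeConjecture-24833`) until
rung 0 closes; REL ≠ ★ ≠ BUILT; this file asserts no named fact, is conditional by construction on its visible binders (`hqcq hPcd hqa hsrc`, and `hG hGeq` in §2), and closes no socket; count-neutral.

## References
* [Rogawski1990] J. D. Rogawski, *Automorphic Representations of Unitary Groups in Three Variables* (1990), §13.9 p. 229 (i)(ii).
* [MoeglinWaldspurger1995] C. Mœglin, J.-L. Waldspurger, *Spectral Decomposition and Eisenstein Series* (1995), IV.1.10–IV.1.11.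
* [Langlands1976] R. P. Langlands, *On the Functional Equations Satisfied by Eisenstein Series*, LNM 544 (1976), §7.
-/

set_option autoImplicit false
set_option linter.dupNamespace false  -- the mandated namespace repeats the single-problem summit's segment

noncomputable section

open scoped NNReal
open Set Filter Topology Complex NumberField IsDedekindDomain
open Literature.NumberTheory.Automorphic Literature.NumberTheory.LFunctions Literature.NumberTheory.GaloisRepresentations
open Summit.HodgeConjecture.HodgeConjecture.Cruxes.H413.K2E1ConvexDiffCountableConnected (countable_of_codiscrete isPreconnected_convex_diff_of_countable)
open Summit.HodgeConjecture.HodgeConjecture.Cruxes.H413.K2E1ChiScatteringEulerQuotientU2 (eventually_nhds_not_mem_of_codiscrete)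
open Summit.HodgeConjecture.HodgeConjecture.Cruxes.H413.K2E1ChiScatteringPoleDichotomyU2 (tendsto_sub_mul_zero_of_eventuallyEq_analyticAt eq_zero_of_tendsto_sub_mul_of_eventuallyEq_analyticAt)
open Summit.HodgeConjecture.HodgeConjecture.Cruxes.H413.K2E1HeckeLHalfNeZeroDefs (LHalfNeZero)
open Summit.HodgeConjecture.HodgeConjecture.Cruxes.H413.K2E1ChiIntertwiningScalarEulerQuotientU3CM (exists_differentiableOn_mul_chiScalar_cm_three)

namespace Summit.HodgeConjecture.HodgeConjecture.Cruxes.H413.K2E1ChiScatteringPoleDichotomyU3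

/-! ## §1 Generic: identity transfer with an entire weight, and the residue at a simple zero of the weight -/

section Generic

/-- **PARAMETRIC IDENTITY TRANSFER ON A HALF-PLANE**: `f` analytic off a co-discrete `P`; `A`, `G` holomorphic on `{a < Re}`; `w` entire; `w z·f z = A z·G z` at every tube point
`b < Re z` off `P` (`a ≤ b`) ⟹ the same at every point of `{a < Re}` off `P` (the open set `{a < Re} ∖ P` is preconnected — a convex open set minus a countable set, ★
`isPreconnected_convex_diff_of_countable` — and contains a tube point by density).  ★ J2 (b) `eqOn_halfPlane_of_eqOn_tube` is the case `a = ½`, `b = 1`, `w = (· − 1)`.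
[cite: MoeglinWaldspurger1995, IV.1.10] [cite: Langlands1976, §7] -/
theorem eqOn_halfPlane_of_eqOn_tube_of_weight {f A G w : ℂ → ℂ} {P : Set ℂ} {a b : ℝ} (hab : a ≤ b) (hPcd : ∀ z₀ : ℂ, ∀ᶠ s in 𝓝[≠] z₀, s ∉ P)
    (hf : ∀ z : ℂ, z ∉ P → AnalyticAt ℂ f z) (hw : Differentiable ℂ w) (hA : DifferentiableOn ℂ A {z : ℂ | a < z.re}) (hG : DifferentiableOn ℂ G {z : ℂ | a < z.re})
    (htube : ∀ z : ℂ, z ∉ P → b < z.re → w z * f z = A z * G z) :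
    ∀ z : ℂ, z ∉ P → a < z.re → w z * f z = A z * G z := by
  intro z hz hzre
  have hopen : IsOpen {u : ℂ | a < u.re} := isOpen_lt continuous_const Complex.continuous_re
  have hcount : P.Countable := countable_of_codiscrete hPcd
  have hpre : IsPreconnected ({u : ℂ | a < u.re} \ P) :=
    isPreconnected_convex_diff_of_countable Literature.Topology.Euclidean.one_lt_rank_real_complex (convex_halfSpace_re_gt a) hopen hcount
  have hfA : AnalyticOnNhd ℂ (fun u => w u * f u) ({u : ℂ | a < u.re} \ P) := fun u hu => (hw.analyticAt u).mul (hf u hu.2)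
  have hgA : AnalyticOnNhd ℂ (fun u => A u * G u) ({u : ℂ | a < u.re} \ P) := fun u hu =>
    (hA.analyticAt (hopen.mem_nhds hu.1)).mul (hG.analyticAt (hopen.mem_nhds hu.1))
  -- a tube point off `P`
  have htopen : IsOpen {u : ℂ | b < u.re} := isOpen_lt continuous_const Complex.continuous_re
  obtain ⟨z₁, hz₁t, hz₁P⟩ := (hcount.dense_compl ℂ).inter_open_nonempty _ htopen
    ⟨((b + 1 : ℝ) : ℂ), by show b < ((b + 1 : ℝ) : ℂ).re; rw [Complex.ofReal_re]; linarith⟩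
  have hz₁t' : b < z₁.re := hz₁t
  have hev : (fun u => w u * f u) =ᶠ[𝓝 z₁] fun u => A u * G u := by
    filter_upwards [htopen.mem_nhds hz₁t, eventually_nhds_not_mem_of_codiscrete hPcd hz₁P] with u hu huP using htube u huP hu
  have h1 : z₁ ∈ {u : ℂ | a < u.re} \ P := ⟨show a < z₁.re by linarith, hz₁P⟩
  exact hfA.eqOn_of_preconnected_of_eventuallyEq hgA hpre h1 hev ⟨hzre, hz⟩

/-- **OFF THE ZEROS OF THE WEIGHT, `f` IS REGULAR**: if `w z·f z = A z·G z` on `{a < Re} ∖ P` and `w z₀ ≠ 0` (`a < Re z₀`), then `f` agrees on a punctured neighbourhood of `z₀` with the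
function `A·G∕w`, analytic at `z₀` — whether or not `z₀ ∈ P`. [cite: MoeglinWaldspurger1995, IV.1.11] [cite: Langlands1976, §7] -/
theorem exists_analyticAt_eventuallyEq_of_weight_ne_zero {f A G w : ℂ → ℂ} {P : Set ℂ} {a : ℝ} (hPcd : ∀ z₀ : ℂ, ∀ᶠ s in 𝓝[≠] z₀, s ∉ P)
    (hw : Differentiable ℂ w) (hA : DifferentiableOn ℂ A {z : ℂ | a < z.re}) (hG : DifferentiableOn ℂ G {z : ℂ | a < z.re})
    (hmain : ∀ z : ℂ, z ∉ P → a < z.re → w z * f z = A z * G z) {z₀ : ℂ} (hz₀ : a < z₀.re) (hwz : w z₀ ≠ 0) :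
    ∃ g : ℂ → ℂ, AnalyticAt ℂ g z₀ ∧ f =ᶠ[𝓝[≠] z₀] g := by
  have hopen : IsOpen {u : ℂ | a < u.re} := isOpen_lt continuous_const Complex.continuous_re
  refine ⟨fun z => A z * G z / w z, ((hA.analyticAt (hopen.mem_nhds hz₀)).mul (hG.analyticAt (hopen.mem_nhds hz₀))).div (hw.analyticAt z₀) hwz, ?_⟩
  have hne : ∀ᶠ s in 𝓝 z₀, w s ≠ 0 := (hw.continuous.continuousAt).eventually_ne hwz
  filter_upwards [hPcd z₀, mem_nhdsWithin_of_mem_nhds (hopen.mem_nhds hz₀), mem_nhdsWithin_of_mem_nhds hne] with s hsP hs hws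
  rw [eq_div_iff hws, mul_comm]
  exact hmain s hsP hs

/-- **THE RESIDUE AT A SIMPLE ZERO OF THE WEIGHT**: if `(z − z₀)·w₁ z·f z = A z·G z` on `{a < Re} ∖ P` with `w₁` entire, `w₁ z₀ ≠ 0`, `a < Re z₀`, then
`(z − z₀)·f z → A z₀·G z₀ ∕ w₁ z₀` along `𝓝[≠] z₀`. [cite: MoeglinWaldspurger1995, IV.1.11] [cite: Langlands1976, §7] -/
theorem tendsto_sub_mul_of_weight {f A G w₁ : ℂ → ℂ} {P : Set ℂ} {a : ℝ} (hPcd : ∀ z₀ : ℂ, ∀ᶠ s in 𝓝[≠] z₀, s ∉ P)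
    (hw₁ : Differentiable ℂ w₁) (hA : DifferentiableOn ℂ A {z : ℂ | a < z.re}) (hG : DifferentiableOn ℂ G {z : ℂ | a < z.re})
    {z₀ : ℂ} (hz₀ : a < z₀.re) (hw₁z : w₁ z₀ ≠ 0) (hmain : ∀ z : ℂ, z ∉ P → a < z.re → (z - z₀) * w₁ z * f z = A z * G z) :
    Tendsto (fun z : ℂ => (z - z₀) * f z) (𝓝[≠] z₀) (𝓝 (A z₀ * G z₀ / w₁ z₀)) := by
  have hopen : IsOpen {u : ℂ | a < u.re} := isOpen_lt continuous_const Complex.continuous_re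
  have hcont : ContinuousAt (fun z => A z * G z / w₁ z) z₀ :=
    (((hA.differentiableAt (hopen.mem_nhds hz₀)).continuousAt).mul ((hG.differentiableAt (hopen.mem_nhds hz₀)).continuousAt)).div
      (hw₁.continuous.continuousAt) hw₁z
  have hne : ∀ᶠ s in 𝓝 z₀, w₁ s ≠ 0 := (hw₁.continuous.continuousAt).eventually_ne hw₁z
  have hev : (fun z : ℂ => (z - z₀) * f z) =ᶠ[𝓝[≠] z₀] fun z => A z * G z / w₁ z := by
    filter_upwards [hPcd z₀, mem_nhdsWithin_of_mem_nhds (hopen.mem_nhds hz₀), mem_nhdsWithin_of_mem_nhds hne] with s hsP hs hws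
    rw [eq_div_iff hws]
    calc (s - z₀) * f s * w₁ s = (s - z₀) * w₁ s * f s := by ring
      _ = A s * G s := hmain s hsP hs
  exact (tendsto_nhdsWithin_of_tendsto_nhds hcont.tendsto).congr' hev.symm

/-- **… AND IF `G z₀ = 0` THERE, `f` IS REGULAR AT `z₀`**: with `G z₀ = 0`, `G = (· − z₀)·dslope G z₀` near `z₀`, so `f = A·(dslope G z₀)∕w₁` on a punctured neighbourhood — analytic at
`z₀` (the `dslope` device of ★ J2 (b) §3). [cite: MoeglinWaldspurger1995, IV.1.11] [cite: Langlands1976, §7] -/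
theorem exists_analyticAt_eventuallyEq_of_apply_eq_zero {f A G w₁ : ℂ → ℂ} {P : Set ℂ} {a : ℝ} (hPcd : ∀ z₀ : ℂ, ∀ᶠ s in 𝓝[≠] z₀, s ∉ P)
    (hw₁ : Differentiable ℂ w₁) (hA : DifferentiableOn ℂ A {z : ℂ | a < z.re}) (hG : DifferentiableOn ℂ G {z : ℂ | a < z.re})
    {z₀ : ℂ} (hz₀ : a < z₀.re) (hw₁z : w₁ z₀ ≠ 0) (hG0 : G z₀ = 0) (hmain : ∀ z : ℂ, z ∉ P → a < z.re → (z - z₀) * w₁ z * f z = A z * G z) :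
    ∃ g : ℂ → ℂ, AnalyticAt ℂ g z₀ ∧ f =ᶠ[𝓝[≠] z₀] g := by
  have hopen : IsOpen {u : ℂ | a < u.re} := isOpen_lt continuous_const Complex.continuous_re
  have hGa : AnalyticAt ℂ G z₀ := hG.analyticAt (hopen.mem_nhds hz₀)
  obtain ⟨p, hp⟩ := hGa
  have hds : AnalyticAt ℂ (dslope G z₀) z₀ := ⟨_, hp.has_fpower_series_dslope_fslope⟩
  refine ⟨fun z => A z * dslope G z₀ z / w₁ z, ((hA.analyticAt (hopen.mem_nhds hz₀)).mul hds).div (hw₁.analyticAt z₀) hw₁z, ?_⟩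
  have hne : ∀ᶠ s in 𝓝 z₀, w₁ s ≠ 0 := (hw₁.continuous.continuousAt).eventually_ne hw₁z
  filter_upwards [hPcd z₀, mem_nhdsWithin_of_mem_nhds (hopen.mem_nhds hz₀), mem_nhdsWithin_of_mem_nhds hne, self_mem_nhdsWithin] with s hsP hs hws hs1
  have hs1' : s - z₀ ≠ 0 := sub_ne_zero.2 hs1
  have hslope : (s - z₀) * dslope G z₀ s = G s := by
    have h := sub_smul_dslope G z₀ s
    rwa [smul_eq_mul, hG0, sub_zero] at h
  have h := hmain s hsP hs
  rw [← hslope] at h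
  -- `h : (s − z₀)·w₁ s·f s = A s·((s − z₀)·dslope G z₀ s)`; cancel `s − z₀`, then divide by `w₁ s`
  have h2 : w₁ s * f s = A s * dslope G z₀ s := by
    have h3 : (s - z₀) * (w₁ s * f s) = (s - z₀) * (A s * dslope G z₀ s) := by
      calc (s - z₀) * (w₁ s * f s) = (s - z₀) * w₁ s * f s := by ring
        _ = A s * ((s - z₀) * dslope G z₀ s) := h
        _ = (s - z₀) * (A s * dslope G z₀ s) := by ring
    exact mul_left_cancel₀ hs1' h3
  rw [eq_div_iff hws, mul_comm]
  exact h2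

end Generic

/-! ## §2 The `N = 3` coordinate: weight `(z−2)(2z−3)`, half-plane `{1 < Re}`, tube `{2 < Re}` -/

section Three

/-- **`(z−2)(2z−3)·qc(z) = A(z)·G(z)` ON `{1 < Re} ∖ P`** — the continued coordinate IS the continued Euler quotient: from the package clauses (`hqcq hPcd hqa`, tube `{2 < Re}`), the
one-source letter `hsrc : q = A·M` on the tube, and the continuation IN SHAPE `hGeq : (z−2)(2z−3)·M z = G z` on the tube with `A`, `G` holomorphic on `{1 < Re}` (F4's MAIN).
[cite: Rogawski1990, §13.9 p. 229] [cite: MoeglinWaldspurger1995, IV.1.10–IV.1.11] -/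
theorem weight_mul_qc_eq_three (q qc : ℂ → ℂ) {P : Set ℂ} (hqcq : ∀ z : ℂ, 2 < z.re → qc z = q z) (hPcd : ∀ z₀ : ℂ, ∀ᶠ s in 𝓝[≠] z₀, s ∉ P)
    (hqa : ∀ z : ℂ, z ∉ P → AnalyticAt ℂ qc z) (A : ℂ → ℂ) (hA : DifferentiableOn ℂ A {z : ℂ | 1 < z.re}) (M : ℂ → ℂ) (hsrc : ∀ z : ℂ, 2 < z.re → q z = A z * M z)
    (G : ℂ → ℂ) (hG : DifferentiableOn ℂ G {z : ℂ | 1 < z.re}) (hGeq : ∀ z : ℂ, 2 < z.re → (z - 2) * (2 * z - 3) * M z = G z) :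
    ∀ z : ℂ, z ∉ P → 1 < z.re → (z - 2) * (2 * z - 3) * qc z = A z * G z := by
  have hw : Differentiable ℂ fun z : ℂ => (z - 2) * (2 * z - 3) :=
    (differentiable_id.sub (differentiable_const 2)).mul ((differentiable_id.const_mul 2).sub (differentiable_const 3))
  refine eqOn_halfPlane_of_eqOn_tube_of_weight (w := fun z : ℂ => (z - 2) * (2 * z - 3)) (by norm_num : (1 : ℝ) ≤ 2) hPcd hqa hw hA hG fun z _ hz => ?_
  show (z - 2) * (2 * z - 3) * qc z = A z * G z
  rw [hqcq z hz, hsrc z hz, ← hGeq z hz]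
  ring

/-- **NO RESIDUE OFF `{2, 3/2}`**: at `z₀ ∉ {2, 3/2}` with `1 < Re z₀` the coordinate `qc` is regular (agrees near `z₀` with `A·G∕((z−2)(2z−3))`), so every residue-limit
`(z − z₀)·qc z → ρ` has `ρ = 0`. [cite: Rogawski1990, §13.9 p. 229] [cite: MoeglinWaldspurger1995, IV.1.11] -/
theorem residue_eq_zero_of_ne_two_of_ne_three_halves (q qc : ℂ → ℂ) {P : Set ℂ} (hqcq : ∀ z : ℂ, 2 < z.re → qc z = q z) (hPcd : ∀ z₀ : ℂ, ∀ᶠ s in 𝓝[≠] z₀, s ∉ P)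
    (hqa : ∀ z : ℂ, z ∉ P → AnalyticAt ℂ qc z) (A : ℂ → ℂ) (hA : DifferentiableOn ℂ A {z : ℂ | 1 < z.re}) (M : ℂ → ℂ) (hsrc : ∀ z : ℂ, 2 < z.re → q z = A z * M z)
    (G : ℂ → ℂ) (hG : DifferentiableOn ℂ G {z : ℂ | 1 < z.re}) (hGeq : ∀ z : ℂ, 2 < z.re → (z - 2) * (2 * z - 3) * M z = G z)
    {z₀ : ℂ} (hz₀ : 1 < z₀.re) (h2 : z₀ ≠ 2) (h32 : z₀ ≠ 3 / 2) {ρ : ℂ} (hρ : Tendsto (fun z : ℂ => (z - z₀) * qc z) (𝓝[≠] z₀) (𝓝 ρ)) : ρ = 0 := by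
  have hw : Differentiable ℂ fun z : ℂ => (z - 2) * (2 * z - 3) :=
    (differentiable_id.sub (differentiable_const 2)).mul ((differentiable_id.const_mul 2).sub (differentiable_const 3))
  have hwz : (z₀ - 2) * (2 * z₀ - 3) ≠ 0 := by
    refine mul_ne_zero (sub_ne_zero.2 h2) ?_
    intro h
    apply h32
    have : (2 : ℂ) * z₀ = 3 := by rwa [sub_eq_zero] at h
    calc z₀ = (2 * z₀) / 2 := by field_simp
      _ = 3 / 2 := by rw [this]
  obtain ⟨g, hg, hfg⟩ := exists_analyticAt_eventuallyEq_of_weight_ne_zero (w := fun z : ℂ => (z - 2) * (2 * z - 3)) hPcd hw hA hG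
    (weight_mul_qc_eq_three q qc hqcq hPcd hqa A hA M hsrc G hG hGeq) hz₀ hwz
  exact eq_zero_of_tendsto_sub_mul_of_eventuallyEq_analyticAt hg hfg hρ

/-- **THE RESIDUE AT THE TOP POLE `z = 2`**: `(z−2)·qc z → A 2 * G 2` along `𝓝[≠] 2` (simple zero of the weight, `w₁ = 2z−3`, `w₁ 2 = 1`).
[cite: Rogawski1990, §13.9 p. 229 (i)] [cite: MoeglinWaldspurger1995, IV.1.11] -/
theorem tendsto_sub_two_mul_qc (q qc : ℂ → ℂ) {P : Set ℂ} (hqcq : ∀ z : ℂ, 2 < z.re → qc z = q z) (hPcd : ∀ z₀ : ℂ, ∀ᶠ s in 𝓝[≠] z₀, s ∉ P)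
    (hqa : ∀ z : ℂ, z ∉ P → AnalyticAt ℂ qc z) (A : ℂ → ℂ) (hA : DifferentiableOn ℂ A {z : ℂ | 1 < z.re}) (M : ℂ → ℂ) (hsrc : ∀ z : ℂ, 2 < z.re → q z = A z * M z)
    (G : ℂ → ℂ) (hG : DifferentiableOn ℂ G {z : ℂ | 1 < z.re}) (hGeq : ∀ z : ℂ, 2 < z.re → (z - 2) * (2 * z - 3) * M z = G z) :
    Tendsto (fun z : ℂ => (z - 2) * qc z) (𝓝[≠] 2) (𝓝 (A 2 * G 2)) := by
  have hw₁ : Differentiable ℂ fun z : ℂ => 2 * z - 3 := (differentiable_id.const_mul 2).sub (differentiable_const 3)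
  have h2re : (1 : ℝ) < (2 : ℂ).re := by norm_num
  have hw₁2 : (2 : ℂ) * 2 - 3 ≠ 0 := by norm_num
  have h := tendsto_sub_mul_of_weight (w₁ := fun z : ℂ => 2 * z - 3) (z₀ := 2) hPcd hw₁ hA hG h2re hw₁2
    (weight_mul_qc_eq_three q qc hqcq hPcd hqa A hA M hsrc G hG hGeq)
  have hval : A 2 * G 2 / ((2 : ℂ) * 2 - 3) = A 2 * G 2 := by norm_num
  rwa [hval] at h

/-- **THE RESIDUE AT THE MIDDLE POLE `z = 3/2`**: `(z − 3/2)·qc z → −(A (3/2) * G (3/2))` along `𝓝[≠] (3/2)` (simple zero of the weight, `w₁ = 2(z−2)`, `w₁ (3/2) = −1`).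
[cite: Rogawski1990, §13.9 p. 229 (ii)] [cite: MoeglinWaldspurger1995, IV.1.11] -/
theorem tendsto_sub_three_halves_mul_qc (q qc : ℂ → ℂ) {P : Set ℂ} (hqcq : ∀ z : ℂ, 2 < z.re → qc z = q z) (hPcd : ∀ z₀ : ℂ, ∀ᶠ s in 𝓝[≠] z₀, s ∉ P)
    (hqa : ∀ z : ℂ, z ∉ P → AnalyticAt ℂ qc z) (A : ℂ → ℂ) (hA : DifferentiableOn ℂ A {z : ℂ | 1 < z.re}) (M : ℂ → ℂ) (hsrc : ∀ z : ℂ, 2 < z.re → q z = A z * M z)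
    (G : ℂ → ℂ) (hG : DifferentiableOn ℂ G {z : ℂ | 1 < z.re}) (hGeq : ∀ z : ℂ, 2 < z.re → (z - 2) * (2 * z - 3) * M z = G z) :
    Tendsto (fun z : ℂ => (z - 3 / 2) * qc z) (𝓝[≠] (3 / 2)) (𝓝 (-(A (3 / 2) * G (3 / 2)))) := by
  have hw₁ : Differentiable ℂ fun z : ℂ => 2 * (z - 2) := (differentiable_id.sub (differentiable_const 2)).const_mul 2
  have h32re : (1 : ℝ) < ((3 : ℂ) / 2).re := by norm_num
  have hw₁32 : (2 : ℂ) * (3 / 2 - 2) ≠ 0 := by norm_num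
  have hmain : ∀ z : ℂ, z ∉ P → 1 < z.re → (z - 3 / 2) * (2 * (z - 2)) * qc z = A z * G z := fun z hzP hz => by
    calc (z - 3 / 2) * (2 * (z - 2)) * qc z = (z - 2) * (2 * z - 3) * qc z := by ring
      _ = A z * G z := weight_mul_qc_eq_three q qc hqcq hPcd hqa A hA M hsrc G hG hGeq z hzP hz
  have h := tendsto_sub_mul_of_weight (w₁ := fun z : ℂ => 2 * (z - 2)) (z₀ := 3 / 2) hPcd hw₁ hA hG h32re hw₁32 hmain
  have hval : A (3 / 2) * G (3 / 2) / ((2 : ℂ) * (3 / 2 - 2)) = -(A (3 / 2) * G (3 / 2)) := by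
    rw [show (2 : ℂ) * (3 / 2 - 2) = -1 by norm_num, div_neg, div_one]
  rwa [hval] at h

/-- **`G 2 = 0` ⟹ `qc` IS REGULAR AT `2`** (no top pole: in the χ-instance this is `φ ≠ 1`). [cite: Rogawski1990, §13.9 p. 229 (i)] [cite: MoeglinWaldspurger1995, IV.1.11] -/
theorem exists_analyticAt_eventuallyEq_qc_of_apply_two_eq_zero (q qc : ℂ → ℂ) {P : Set ℂ} (hqcq : ∀ z : ℂ, 2 < z.re → qc z = q z) (hPcd : ∀ z₀ : ℂ, ∀ᶠ s in 𝓝[≠] z₀, s ∉ P)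
    (hqa : ∀ z : ℂ, z ∉ P → AnalyticAt ℂ qc z) (A : ℂ → ℂ) (hA : DifferentiableOn ℂ A {z : ℂ | 1 < z.re}) (M : ℂ → ℂ) (hsrc : ∀ z : ℂ, 2 < z.re → q z = A z * M z)
    (G : ℂ → ℂ) (hG : DifferentiableOn ℂ G {z : ℂ | 1 < z.re}) (hGeq : ∀ z : ℂ, 2 < z.re → (z - 2) * (2 * z - 3) * M z = G z) (hG2 : G 2 = 0) :
    ∃ g : ℂ → ℂ, AnalyticAt ℂ g 2 ∧ qc =ᶠ[𝓝[≠] 2] g := by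
  have hw₁ : Differentiable ℂ fun z : ℂ => 2 * z - 3 := (differentiable_id.const_mul 2).sub (differentiable_const 3)
  have h2re : (1 : ℝ) < (2 : ℂ).re := by norm_num
  have hw₁2 : (2 : ℂ) * 2 - 3 ≠ 0 := by norm_num
  exact exists_analyticAt_eventuallyEq_of_apply_eq_zero (w₁ := fun z : ℂ => 2 * z - 3) (z₀ := 2) hPcd hw₁ hA hG h2re hw₁2 hG2
    (weight_mul_qc_eq_three q qc hqcq hPcd hqa A hA M hsrc G hG hGeq)

/-- **`G (3/2) = 0` ⟹ `qc` IS REGULAR AT `3/2`** (no middle pole: in the χ-instance this is `η ≠ 1`, or `η = 1 ∧ L(½, φ) = 0`). [cite: Rogawski1990, §13.9 p. 229 (ii)]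
[cite: MoeglinWaldspurger1995, IV.1.11] -/
theorem exists_analyticAt_eventuallyEq_qc_of_apply_three_halves_eq_zero (q qc : ℂ → ℂ) {P : Set ℂ} (hqcq : ∀ z : ℂ, 2 < z.re → qc z = q z)
    (hPcd : ∀ z₀ : ℂ, ∀ᶠ s in 𝓝[≠] z₀, s ∉ P) (hqa : ∀ z : ℂ, z ∉ P → AnalyticAt ℂ qc z) (A : ℂ → ℂ) (hA : DifferentiableOn ℂ A {z : ℂ | 1 < z.re}) (M : ℂ → ℂ)
    (hsrc : ∀ z : ℂ, 2 < z.re → q z = A z * M z) (G : ℂ → ℂ) (hG : DifferentiableOn ℂ G {z : ℂ | 1 < z.re}) (hGeq : ∀ z : ℂ, 2 < z.re → (z - 2) * (2 * z - 3) * M z = G z)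
    (hG32 : G (3 / 2) = 0) :
    ∃ g : ℂ → ℂ, AnalyticAt ℂ g (3 / 2) ∧ qc =ᶠ[𝓝[≠] (3 / 2)] g := by
  have hw₁ : Differentiable ℂ fun z : ℂ => 2 * (z - 2) := (differentiable_id.sub (differentiable_const 2)).const_mul 2
  have h32re : (1 : ℝ) < ((3 : ℂ) / 2).re := by norm_num
  have hw₁32 : (2 : ℂ) * (3 / 2 - 2) ≠ 0 := by norm_num
  have hmain : ∀ z : ℂ, z ∉ P → 1 < z.re → (z - 3 / 2) * (2 * (z - 2)) * qc z = A z * G z := fun z hzP hz => by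
    calc (z - 3 / 2) * (2 * (z - 2)) * qc z = (z - 2) * (2 * z - 3) * qc z := by ring
      _ = A z * G z := weight_mul_qc_eq_three q qc hqcq hPcd hqa A hA M hsrc G hG hGeq z hzP hz
  exact exists_analyticAt_eventuallyEq_of_apply_eq_zero (w₁ := fun z : ℂ => 2 * (z - 2)) (z₀ := 3 / 2) hPcd hw₁ hA hG h32re hw₁32 hG32 hmain

/-- **THE POLE DICHOTOMY (pole currency)**: with a finite pole set `Sp ⊂ (1, σ₀)` and residue letters `hr : (z − c)·qc z → ρ c` at each `c ∈ Sp` (the shape of the self-dual block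
package's pole data, ★ p860865 with `½ ↦ 1`): a NON-ZERO residue `ρ c ≠ 0` forces `c = 2` with `ρ c = A 2 * G 2`, or `c = 3/2` with `ρ c = −(A (3/2) * G (3/2))`.  («Poles of `M(·, χ)`
in `Re s > 0` lie in `{1, ½}`», [Rogawski1990, §13.9 p. 229 (i)(ii)] through `s = z − 1`.) [cite: Rogawski1990, §13.9 p. 229] [cite: MoeglinWaldspurger1995, IV.1.11] -/
theorem poles_subset_of_residue_ne_zero (q qc : ℂ → ℂ) {P : Set ℂ} (hqcq : ∀ z : ℂ, 2 < z.re → qc z = q z) (hPcd : ∀ z₀ : ℂ, ∀ᶠ s in 𝓝[≠] z₀, s ∉ P)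
    (hqa : ∀ z : ℂ, z ∉ P → AnalyticAt ℂ qc z) (A : ℂ → ℂ) (hA : DifferentiableOn ℂ A {z : ℂ | 1 < z.re}) (M : ℂ → ℂ) (hsrc : ∀ z : ℂ, 2 < z.re → q z = A z * M z)
    (G : ℂ → ℂ) (hG : DifferentiableOn ℂ G {z : ℂ | 1 < z.re}) (hGeq : ∀ z : ℂ, 2 < z.re → (z - 2) * (2 * z - 3) * M z = G z)
    {σ₀ : ℝ} (Sp : Finset ℝ) (hSp : ∀ c ∈ Sp, 1 < c ∧ c < σ₀) (ρ : ℝ → ℂ)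
    (hr : ∀ c ∈ Sp, Tendsto (fun z : ℂ => (z - c) * qc z) (𝓝[≠] (c : ℂ)) (𝓝 (ρ c))) :
    ∀ c ∈ Sp, ρ c ≠ 0 → (c = 2 ∧ ρ c = A 2 * G 2) ∨ (c = 3 / 2 ∧ ρ c = -(A (3 / 2) * G (3 / 2))) := by
  intro c hc hρ0
  have hz₀ : 1 < ((c : ℂ)).re := by rw [Complex.ofReal_re]; exact (hSp c hc).1
  by_cases h2 : (c : ℂ) = 2
  · refine Or.inl ⟨by exact_mod_cast h2, ?_⟩
    have hlim := hr c hc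
    rw [h2] at hlim
    exact tendsto_nhds_unique hlim (tendsto_sub_two_mul_qc q qc hqcq hPcd hqa A hA M hsrc G hG hGeq)
  by_cases h32 : (c : ℂ) = 3 / 2
  · have hc32 : c = 3 / 2 := by
      apply Complex.ofReal_injective
      rw [h32]
      norm_num
    refine Or.inr ⟨hc32, ?_⟩
    have hlim := hr c hc
    rw [h32] at hlim
    exact tendsto_nhds_unique hlim (tendsto_sub_three_halves_mul_qc q qc hqcq hPcd hqa A hA M hsrc G hG hGeq)
  exact absurd (residue_eq_zero_of_ne_two_of_ne_three_halves q qc hqcq hPcd hqa A hA M hsrc G hG hGeq hz₀ h2 h32 (hr c hc)) hρ0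

/-- **… so if `G` vanishes at both `2` and `3/2`, the block carries NO weighted pole: `∀ c ∈ Sp, ρ c = 0`** (in the χ-instance: `φ ≠ 1` and (`η ≠ 1` or `L(½, φ) = 0`) ⇒ the
`χ`-Eisenstein family of `U(2,1)` contributes nothing to `L²_res`). [cite: Rogawski1990, §13.9 p. 229] [cite: MoeglinWaldspurger1995, IV.1.11] -/
theorem forall_residue_eq_zero_of_apply_eq_zero (q qc : ℂ → ℂ) {P : Set ℂ} (hqcq : ∀ z : ℂ, 2 < z.re → qc z = q z) (hPcd : ∀ z₀ : ℂ, ∀ᶠ s in 𝓝[≠] z₀, s ∉ P)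
    (hqa : ∀ z : ℂ, z ∉ P → AnalyticAt ℂ qc z) (A : ℂ → ℂ) (hA : DifferentiableOn ℂ A {z : ℂ | 1 < z.re}) (M : ℂ → ℂ) (hsrc : ∀ z : ℂ, 2 < z.re → q z = A z * M z)
    (G : ℂ → ℂ) (hG : DifferentiableOn ℂ G {z : ℂ | 1 < z.re}) (hGeq : ∀ z : ℂ, 2 < z.re → (z - 2) * (2 * z - 3) * M z = G z) (hG2 : G 2 = 0) (hG32 : G (3 / 2) = 0)
    {σ₀ : ℝ} (Sp : Finset ℝ) (hSp : ∀ c ∈ Sp, 1 < c ∧ c < σ₀) (ρ : ℝ → ℂ)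
    (hr : ∀ c ∈ Sp, Tendsto (fun z : ℂ => (z - c) * qc z) (𝓝[≠] (c : ℂ)) (𝓝 (ρ c))) :
    ∀ c ∈ Sp, ρ c = 0 := by
  intro c hc
  by_contra hρ0
  rcases poles_subset_of_residue_ne_zero q qc hqcq hPcd hqa A hA M hsrc G hG hGeq Sp hSp ρ hr c hc hρ0 with ⟨-, h⟩ | ⟨-, h⟩
  · exact hρ0 (by rw [h, hG2, mul_zero])
  · exact hρ0 (by rw [h, hG32, mul_zero, neg_zero])

end Three

/-! ## §3 (ED. 2) The CM print BY NAME at ★ F4: `M := c_χ^S`, the character form of the two residue conditions -/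

section CM

variable (L : Type) [Field L] [NumberField L]

/-- **THE POLE DICHOTOMY OF THE `χ`-SCATTERING COORDINATE OF `U(2,1)_{L∕L⁺}`, CHARACTER FORM** — ★ F4 `exists_differentiableOn_mul_chiScalar_cm_three` plugged into §2
`poles_subset_of_residue_ne_zero`: for one coordinate `(q, qc, P)` of a continued χ-scattering package with the one-source letter `hsrc : q = A·c_χ^S` on `{2 < Re}` (`c_χ^S` in F4's
bytes; `A` holomorphic on `{1 < Re}`), a finite pole set `Sp ⊂ (1, σ₀)` with residue letters `hr`: a NON-ZERO residue `ρ c ≠ 0` forces EITHER `c = 2 ∧ φ = 1 ∧ A 2 ≠ 0` (top pole,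
[Rogawski1990 §13.9 (i)] `s = 1`, `φ` trivial) OR `c = 3/2 ∧ η = 1 ∧ A (3/2) ≠ 0 ∧ (φ ≠ 1 → L(½, φ) ≠ 0)` (middle pole, (ii) `s = ½`, `φ′ = ω_{L∕L⁺}` i.e. `η = 1`, `L(½, φ) ≠ 0`; the
`(φ, η) = (1, 1)` middle value is not exported by F4, whence the guard `φ ≠ 1 →`). [cite: Rogawski1990, §13.9 p. 229 (i)(ii)] [cite: MoeglinWaldspurger1995, IV.1.11] -/
theorem forall_poles_of_residue_ne_zero_cm_three {φ : HeckeCharacter L} {η : HeckeCharacter ↥(maximalRealSubfield L)}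
    {S : Set (HeightOneSpectrum (𝓞 L))} {T : Set (HeightOneSpectrum (𝓞 ↥(maximalRealSubfield L)))}
    (hφ : φ.IsUnitary) (hφA : ∀ t : ℝ≥0ˣ, φ (posRealIdele L t) = 1) (hS : S.Finite) (hurφ : ∀ w ∉ S, φ.IsUnramifiedAt w)
    (hη : η.IsUnitary) (hηA : ∀ t : ℝ≥0ˣ, η (posRealIdele ↥(maximalRealSubfield L) t) = 1) (hT : T.Finite) (hurη : ∀ v ∉ T, η.IsUnramifiedAt v)
    (q qc : ℂ → ℂ) {P : Set ℂ} (hqcq : ∀ z : ℂ, 2 < z.re → qc z = q z) (hPcd : ∀ z₀ : ℂ, ∀ᶠ s in 𝓝[≠] z₀, s ∉ P) (hqa : ∀ z : ℂ, z ∉ P → AnalyticAt ℂ qc z)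
    (A : ℂ → ℂ) (hA : DifferentiableOn ℂ A {z : ℂ | 1 < z.re})
    (hsrc : ∀ z : ℂ, 2 < z.re → q z = A z *
          ((partialStandardL S (fun w => {φ.valueAtUniformizer w}) (z - 1) * partialStandardL T (fun v => {η.valueAtUniformizer v}) (2 * z - 2)) /
            (partialStandardL S (fun w => {φ.valueAtUniformizer w}) z * partialStandardL T (fun v => {η.valueAtUniformizer v}) (2 * z - 1))))
    {σ₀ : ℝ} (Sp : Finset ℝ) (hSp : ∀ c ∈ Sp, 1 < c ∧ c < σ₀) (ρ : ℝ → ℂ)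
    (hr : ∀ c ∈ Sp, Tendsto (fun z : ℂ => (z - c) * qc z) (𝓝[≠] (c : ℂ)) (𝓝 (ρ c))) :
    ∀ c ∈ Sp, ρ c ≠ 0 → (c = 2 ∧ φ = 1 ∧ A 2 ≠ 0) ∨ (c = 3 / 2 ∧ η = 1 ∧ A (3 / 2) ≠ 0 ∧ (φ ≠ 1 → LHalfNeZero φ)) := by
  obtain ⟨G, hG, hGeq, hG2, hG0, hG32⟩ := exists_differentiableOn_mul_chiScalar_cm_three L hφ hφA hS hurφ hη hηA hT hurη
  intro c hc hρ0
  rcases poles_subset_of_residue_ne_zero q qc hqcq hPcd hqa A hA _ hsrc G hG hGeq Sp hSp ρ hr c hc hρ0 with ⟨hc2, hρ⟩ | ⟨hc32, hρ⟩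
  · rw [hρ] at hρ0
    exact Or.inl ⟨hc2, hG2.1 (right_ne_zero_of_mul hρ0), left_ne_zero_of_mul hρ0⟩
  · rw [hρ, neg_ne_zero] at hρ0
    have hG32ne : G (3 / 2) ≠ 0 := right_ne_zero_of_mul hρ0
    have hη1 : η = 1 := by
      by_contra h
      exact hG32ne (hG0 h)
    exact Or.inr ⟨hc32, hη1, left_ne_zero_of_mul hρ0, fun hφ1 => (hG32 hη1 hφ1).1 hG32ne⟩

/-- **… HENCE, for `φ ≠ 1` with (`η ≠ 1` or `L(½, φ) = 0`), NO WEIGHTED POLE AT ALL: `∀ c ∈ Sp, ρ c = 0`** — the `χ`-Eisenstein family of `U(2,1)` with such `(φ, η)` contributes nothing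
to `L²_res`. [cite: Rogawski1990, §13.9 p. 229 (i)(ii)] [cite: MoeglinWaldspurger1995, IV.1.11] -/
theorem forall_residue_eq_zero_cm_three {φ : HeckeCharacter L} {η : HeckeCharacter ↥(maximalRealSubfield L)}
    {S : Set (HeightOneSpectrum (𝓞 L))} {T : Set (HeightOneSpectrum (𝓞 ↥(maximalRealSubfield L)))}
    (hφ : φ.IsUnitary) (hφA : ∀ t : ℝ≥0ˣ, φ (posRealIdele L t) = 1) (hS : S.Finite) (hurφ : ∀ w ∉ S, φ.IsUnramifiedAt w)
    (hη : η.IsUnitary) (hηA : ∀ t : ℝ≥0ˣ, η (posRealIdele ↥(maximalRealSubfield L) t) = 1) (hT : T.Finite) (hurη : ∀ v ∉ T, η.IsUnramifiedAt v)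
    (q qc : ℂ → ℂ) {P : Set ℂ} (hqcq : ∀ z : ℂ, 2 < z.re → qc z = q z) (hPcd : ∀ z₀ : ℂ, ∀ᶠ s in 𝓝[≠] z₀, s ∉ P) (hqa : ∀ z : ℂ, z ∉ P → AnalyticAt ℂ qc z)
    (A : ℂ → ℂ) (hA : DifferentiableOn ℂ A {z : ℂ | 1 < z.re})
    (hsrc : ∀ z : ℂ, 2 < z.re → q z = A z *
          ((partialStandardL S (fun w => {φ.valueAtUniformizer w}) (z - 1) * partialStandardL T (fun v => {η.valueAtUniformizer v}) (2 * z - 2)) /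
            (partialStandardL S (fun w => {φ.valueAtUniformizer w}) z * partialStandardL T (fun v => {η.valueAtUniformizer v}) (2 * z - 1))))
    (hφ1 : φ ≠ 1) (hmid : η = 1 → ¬ LHalfNeZero φ)
    {σ₀ : ℝ} (Sp : Finset ℝ) (hSp : ∀ c ∈ Sp, 1 < c ∧ c < σ₀) (ρ : ℝ → ℂ)
    (hr : ∀ c ∈ Sp, Tendsto (fun z : ℂ => (z - c) * qc z) (𝓝[≠] (c : ℂ)) (𝓝 (ρ c))) :
    ∀ c ∈ Sp, ρ c = 0 := by
  intro c hc
  by_contra hρ0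
  rcases forall_poles_of_residue_ne_zero_cm_three L hφ hφA hS hurφ hη hηA hT hurη q qc hqcq hPcd hqa A hA hsrc Sp hSp ρ hr c hc hρ0 with ⟨-, h1, -⟩ | ⟨-, hη1, -, hL⟩
  · exact hφ1 h1
  · exact hmid hη1 (hL hφ1)

/-- **THE RESIDUE AT THE TOP POLE `z = 2`, CHARACTER FORM**: any residue-limit `(z − 2)·qc z → ρ` IS `A(2)·G(2)` for the ★ F4 continuation `G` (`G 2 ≠ 0 ⟺ φ = 1`); in particular
`ρ ≠ 0 ⟺ (φ = 1 ∧ A 2 ≠ 0)`. [cite: Rogawski1990, §13.9 p. 229 (i)] [cite: MoeglinWaldspurger1995, IV.1.11] -/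
theorem residue_at_two_eq_cm_three {φ : HeckeCharacter L} {η : HeckeCharacter ↥(maximalRealSubfield L)}
    {S : Set (HeightOneSpectrum (𝓞 L))} {T : Set (HeightOneSpectrum (𝓞 ↥(maximalRealSubfield L)))}
    (hφ : φ.IsUnitary) (hφA : ∀ t : ℝ≥0ˣ, φ (posRealIdele L t) = 1) (hS : S.Finite) (hurφ : ∀ w ∉ S, φ.IsUnramifiedAt w)
    (hη : η.IsUnitary) (hηA : ∀ t : ℝ≥0ˣ, η (posRealIdele ↥(maximalRealSubfield L) t) = 1) (hT : T.Finite) (hurη : ∀ v ∉ T, η.IsUnramifiedAt v)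
    (q qc : ℂ → ℂ) {P : Set ℂ} (hqcq : ∀ z : ℂ, 2 < z.re → qc z = q z) (hPcd : ∀ z₀ : ℂ, ∀ᶠ s in 𝓝[≠] z₀, s ∉ P) (hqa : ∀ z : ℂ, z ∉ P → AnalyticAt ℂ qc z)
    (A : ℂ → ℂ) (hA : DifferentiableOn ℂ A {z : ℂ | 1 < z.re})
    (hsrc : ∀ z : ℂ, 2 < z.re → q z = A z *
          ((partialStandardL S (fun w => {φ.valueAtUniformizer w}) (z - 1) * partialStandardL T (fun v => {η.valueAtUniformizer v}) (2 * z - 2)) /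
            (partialStandardL S (fun w => {φ.valueAtUniformizer w}) z * partialStandardL T (fun v => {η.valueAtUniformizer v}) (2 * z - 1))))
    {ρ : ℂ} (hρ : Tendsto (fun z : ℂ => (z - 2) * qc z) (𝓝[≠] 2) (𝓝 ρ)) :
    ∃ G : ℂ → ℂ, DifferentiableOn ℂ G {z : ℂ | 1 < z.re} ∧ (G 2 ≠ 0 ↔ φ = 1) ∧ ρ = A 2 * G 2 ∧ (ρ ≠ 0 ↔ φ = 1 ∧ A 2 ≠ 0) := by
  obtain ⟨G, hG, hGeq, hG2, -, -⟩ := exists_differentiableOn_mul_chiScalar_cm_three L hφ hφA hS hurφ hη hηA hT hurη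
  have hρeq : ρ = A 2 * G 2 := tendsto_nhds_unique hρ (tendsto_sub_two_mul_qc q qc hqcq hPcd hqa A hA _ hsrc G hG hGeq)
  refine ⟨G, hG, hG2, hρeq, ?_⟩
  rw [hρeq, mul_ne_zero_iff, ← hG2]
  exact ⟨fun h => ⟨h.2, h.1⟩, fun h => ⟨h.2, h.1⟩⟩

end CM

end Summit.HodgeConjecture.HodgeConjecture.Cruxes.H413.K2E1ChiScatteringPoleDichotomyU3

end
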